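import Summits.BirchSwinnertonDyer.BirchSwinnertonDyer.Theorems.ManinLocalTwoThreeManinOddAtFourOfStevensParity
import Summits.BirchSwinnertonDyer.BirchSwinnertonDyer.Theorems.ManinLocalTwoThreeGammaOneKatoRoad
import Summits.BirchSwinnertonDyer.BirchSwinnertonDyer.Theorems.ManinLocalTwoThreeGammaOneKatoRoadHolds
import Summits.BirchSwinnertonDyer.BirchSwinnertonDyer.Theorems.ManinLocalTwoThreeKatoFactTwoAtOddIsogeny
import Summits.BirchSwinnertonDyer.BirchSwinnertonDyer.Theorems.ManinLocalTwoThreeNegOneTwistConductorTwoMulHolds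
import Literature.NumberTheory.EllipticCurves.IsogenyIdProofs
import HarnessLib

/-!
# C2 `ManinOddAtFour` LEVEL-WISE, and its `16 ∣ N` reading: `ManinOddAtSixteen` ⟸ four printed facts ∧ three laws READ AT `16 ∣ N`
# (route `ManinLocalTwoThree`, cell bsd-f2-manin; crux C2 `ManinOddAtFour` stmt-BirchSwinnertonDyer-22967; LEAD seat p1 gen 13 —
# the SPLIT-16 trigger of 2026-08-29T04:58:06Z: S-an-58 `negOneTwistConductorFourMul_holds` (p2, p696508), S-an-60
# `negOneTwistConductorTwoMul_holds` (p2, p698743), B5b `ManinOddAtSixteen` + glue (typer, p698181))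

THE POINT.  The composition of the C2 skeleton of record (`kato_shift_two` v15: `maninOddAtFour_of_katoFact_of_cuspidalKummer_of_
cusp_rational_of_gammaOneOdd`, p683655, + the Γ₁ Kato lever `gammaOneOddOnBlindClasses_of_katoGamma1`, p688868) consumes its three
OPEN LAWS (E-an-48 `CuspidalKummerRepresentativeAtFour`, E-an-53 `CuspidalKummerOddExponent`, E-es-110
`KatoCurve.KatoNeronIntegralTwoGamma1Optimal`) as GLOBAL statements (every level `4 ∣ N`).  Every edge of that composition is in
fact LOCAL TO THE LEVEL: the Kato lever, the cuspidal-Kummer certificate, the blind transfer `|c₀| = |c₁|` and the Γ₁ lever all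
work with ONE lattice-optimal datum and curves isogenous to it AT THE SAME LEVEL.  This file records the composition in that
LEVEL-WISE form (`not_two_dvd_maninConstant_of_katoFact_of_levelLaws`: for a fixed level `N` with `4 ∣ N`, the three laws AT
LEVEL `N` + the printed facts give `2 ∤ c` for every lattice-optimal `X₀(N)`-datum), so that ANY re-indexing of the crux to a set
of levels is a one-line corollary.  Two corollaries are drawn:

* **`maninOddAtSixteen_of_katoFact_of_levelSixteenLaws`** — an's `ManinOddAtSixteen` (S-an-62, the crux VERBATIM with
  `2 ^ 4 ∣ N`) from F♯, F★, `exists_optimal_gamma1ParametrizationData`, F-es-21♭K (four printed / Literature statement-only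
  facts) and the three laws READ AT `16 ∣ N` ONLY, with stub 6′ (E-es-110) moreover RECUT per es §40.12 (v): an optimal
  `X₁(N)`-datum whose curve has a globally minimal ODD-degree-isogenous SYMBOL-CLOSURE neighbour needs no law — p3's
  `katoFactTwoAt_of_oddIsogeny_of_isSymbolClosureCurve` (p699401) discharges it from F-es-21♭K;
* **`maninOddAtFour_of_katoFact_of_levelSixteenLaws`** — the ROUTE DECL `Theses.ManinLocalTwoThree.ManinOddAtFour` BY NAME from
  the same seven inputs, through p2's print-free `maninOddAtFour_of_maninOddAtSixteen'` (p698743) — the composition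
  `ManinOddAtFour_of` of skeleton v16 of line `kato_shift_two`;
* and, as a check that nothing was lost, v15's global composition re-derived (`maninOddAtFour_of_katoFact_of_cuspidalKummer_of_
  cusp_rational_of_katoGamma1`, laws at every `4 ∣ N`, E-es-110 instead of C2¹).

HONEST FRAMING.  A CONDITIONAL reduction and a re-indexing, not a closure: F♯ / F★ / hex / F-es-21♭K are statement-only
Literature readings of Kato 2004, Conrad–Edixhoven–Stein 2003, Stevens 1989 and Kato–Wuthrich; E-an-48, E-an-53 and E-es-110 are
OPEN cell laws (now needed at `16 ∣ N` only; in Cremona's range `N ≤ 5000` the recut stub 6″ meets the single class 32a1 by es's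
census E40/§40.13 — a census statement, not a theorem).  C2, Manin's conjecture, Stevens' conjecture and BSD are NOT proved by this
file.  No definitions, no sorry, axioms standard.
-/

set_option autoImplicit false
set_option linter.dupNamespace false

noncomputable section

open scoped Classical MatrixGroups ModularForm
open PowerSeries CongruenceSubgroup
open WeierstrassCurve Literature.NumberTheory.EllipticCurves Literature.NumberTheory.EllipticCurves.ModularForms
  Literature.RingTheory.FormalGroups
open Summit.BirchSwinnertonDyer.Rank1Residual.ManinAdditive
open Summit.BirchSwinnertonDyer.Rank1Residual.ManinAdditive.CuspidalKummer
open Summit.BirchSwinnertonDyer.Rank1Residual.ManinAdditive.ShimuraLedger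
open Summit.BirchSwinnertonDyer.Rank1Residual.ManinAdditive.KatoCurve

namespace Summit.BirchSwinnertonDyer.BirchSwinnertonDyer.Theorems.ManinLocalTwoThree

/-! ## §1 The blind side AT LEVEL `N`: `KatoFactTwoAt` at the `X₁(N)`-optimal curve ⟹ `2 ∤ c₁` ⟹ (transfer mod F★) `2 ∤ c₀` -/

/-- **`2 ∤ c₁` at level `N` from Kato–Néron integrality at the `X₁(N)`-optimal curve** (the Γ₁ lever
`GammaOneKatoRoad.not_two_dvd_maninConstant₁_of_katoFact_of_witness` + the E-es-111 theorem `twoAdicGammaOneWitnessLaw_holds`; additivity at `2`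
from `4 ∣ N` by `additive_of_four_dvd_level`). [cite: Kato2004Asterisque, Thm. 12.5 (1) (p. 221) (shape of the integrality input)] -/
theorem not_two_dvd_maninConstant₁_of_katoFactAt
    (V : WeierstrassCurve ℚ) [V.IsElliptic] [V.IsGloballyMinimal] {N : ℕ} [NeZero N]
    (D₁ : Gamma1ParametrizationData V N) (hopt : D₁.IsOptimal) (h4 : 2 ^ 2 ∣ N) (hK : KatoFactTwoAt V D₁.f) :
    ¬ (2 : ℤ) ∣ D₁.maninConstant := by
  obtain ⟨hg, hmu⟩ := additive_of_four_dvd_level V D₁.f D₁.isNewformOf h4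
  exact GammaOneKatoRoad.not_two_dvd_maninConstant₁_of_katoFact_of_witness V D₁ hopt hK hg hmu
    (twoAdicGammaOneWitnessLaw_holds V D₁ hopt hg hmu)

/-- **The totally blind residual AT LEVEL `N`** (an g16's `RbTotallyBlind`, one level): for `4 ∣ N`, F★ (blind transfer
`|c₀| = |c₁|`, `totallyBlindGammaOneTransfer_of_cusp_rational`), the existence of Stevens' optimal `X₁(N)`-datum in the class, and
`KatoFactTwoAt` at every `X₁(N)`-optimal curve OF LEVEL `N` give `2 ∤ c₀` for every lattice-optimal `a₁ = a₃ = 0` datum of level `N`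
all of whose rational 2-torsion is Kummer-blind. [cite: ConradEdixhovenStein2003, §6.1.2 and §6.2 (F★)] -/
theorem rbTotallyBlindAt_of_cusp_rational_of_katoFactAt
    (hFstar : optimalGamma1Parametrization_cusp_rational) (hex : exists_optimal_gamma1ParametrizationData)
    {N : ℕ} [NeZero N] (h4 : 2 ^ 2 ∣ N)
    (h110N : ∀ (V : WeierstrassCurve ℚ) [V.IsElliptic] [V.IsGloballyMinimal] (D₁ : Gamma1ParametrizationData V N),
      D₁.IsOptimal → KatoFactTwoAt V D₁.f)
    (W₀ : WeierstrassCurve ℚ) [W₀.IsElliptic] [W₀.IsGloballyMinimal] (D₀ : ModularParametrizationData W₀ N)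
    (hopt : ∀ z ∈ D₀.L.lattice, ∃ w ∈ periodLattice D₀.f, z = D₀.c * w) (ha₁ : W₀.a₁ = 0) (ha₃ : W₀.a₃ = 0)
    (hall : AllRationalTwoTorsionBlind W₀) : ¬ (2 : ℤ) ∣ D₀.maninConstant := by
  obtain ⟨W₁, i₁, i₂, D₁, hiso, hD₁⟩ := hex W₀ D₀ hopt
  have heq := totallyBlindGammaOneTransfer_of_cusp_rational hFstar W₁ W₀ D₁ D₀ hiso hD₁ hopt h4 ha₁ ha₃ hall
  have hodd : ¬ (2 : ℤ) ∣ D₁.maninConstant :=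
    not_two_dvd_maninConstant₁_of_katoFactAt W₁ D₁ hD₁ h4 (h110N W₁ D₁ hD₁)
  intro hdvd
  apply hodd
  have : (2 : ℤ).natAbs ∣ D₁.maninConstant.natAbs := by
    rw [← heq]; exact Int.natAbs_dvd_natAbs.mpr hdvd
  exact Int.natAbs_dvd_natAbs.mp this

/-- **E-an-50 AT LEVEL `N`** (integer-root form of the blind residual, as consumed by the cuspidal-Kummer composition): the
rational-root form above + the rational root theorem on a globally minimal `a₁ = a₃ = 0` equation
(`exists_intCast_eq_of_isRoot_twoTorsionPolynomial`). [folklore] -/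
theorem kummerBlindResidualOddAt_of_cusp_rational_of_katoFactAt
    (hFstar : optimalGamma1Parametrization_cusp_rational) (hex : exists_optimal_gamma1ParametrizationData)
    {N : ℕ} [NeZero N] (h4 : 2 ^ 2 ∣ N)
    (h110N : ∀ (V : WeierstrassCurve ℚ) [V.IsElliptic] [V.IsGloballyMinimal] (D₁ : Gamma1ParametrizationData V N),
      D₁.IsOptimal → KatoFactTwoAt V D₁.f)
    (W : WeierstrassCurve ℚ) [W.IsElliptic] [W.IsGloballyMinimal] (D : ModularParametrizationData W N)
    (hopt : ∀ z ∈ D.L.lattice, ∃ w ∈ periodLattice D.f, z = D.c * w) (a₂ a₄ : ℤ)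
    (hW₁ : W.a₁ = 0) (hW₃ : W.a₃ = 0) (hW₂ : W.a₂ = a₂) (hW₄ : W.a₄ = a₄)
    (hall : ∀ e : ℤ, W.twoTorsionPolynomial.toPoly.IsRoot (e : ℚ) → KummerBlindAtTwo a₂ a₄ e) :
    ¬ (2 : ℤ) ∣ D.maninConstant := by
  set M : WeierstrassCurve ℤ := integralModelInt W with hM
  have hWM : M.map (Int.castRingHom ℚ) = W := map_integralModelInt W
  have hM1 : M.a₁ = 0 := by
    have h := hW₁; rw [← hWM, map_a₁, eq_intCast] at h; exact_mod_cast h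
  have hM3 : M.a₃ = 0 := by
    have h := hW₃; rw [← hWM, map_a₃, eq_intCast] at h; exact_mod_cast h
  refine rbTotallyBlindAt_of_cusp_rational_of_katoFactAt hFstar hex h4 h110N W D hopt hW₁ hW₃ ?_
  intro e he
  have he' : W.twoTorsionPolynomial.toPoly.IsRoot e := (isRoot_twoTorsionPolynomial_iff_of_a₁_a₃ W hW₁ hW₃ e).mpr he
  have heM : (M.map (Int.castRingHom ℚ)).twoTorsionPolynomial.toPoly.IsRoot e := by rw [hWM]; exact he'
  obtain ⟨E, rfl⟩ := exists_intCast_eq_of_isRoot_twoTorsionPolynomial M hM1 hM3 heM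
  exact ⟨a₂, a₄, E, hW₂.symm, hW₄.symm, rfl, hall E he'⟩

/-! ## §2 C2 AT LEVEL `N`: the three laws AT LEVEL `N` + the printed facts ⟹ `2 ∤ c` for every lattice-optimal datum of level `N` -/

/-- **C2 LEVEL-WISE** (the composition of skeleton `kato_shift_two` made local to the level).  Fix `N` with `4 ∣ N`.  From
F♯ (Kato, real-subfield reading), F★, the existence of Stevens' optimal `X₁(N)`-datum, and AT LEVEL `N` ONLY: E-an-48
(cuspidal Kummer representatives), E-an-53 (odd `η`-exponent at a non-blind point) and `KatoFactTwoAt` at every `X₁(N)`-optimal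
curve — every lattice-optimal `X₀(N)`-datum of a globally minimal curve has odd Manin constant.  Irreducible `W[2]`: the Kato lever
(`katoManinOddTwo_of_realKatoFact_of_generation` + the theorem `multiShiftClassGenerationTwo_holds`); reducible: the `u = 1`
change to the minimal `a₁ = a₃ = 0` model (`exists_smul_eq_map_a₁_a₃_eq_zero_of_hasAdditiveReductionAt_two`, the datum transported
with the same `c`), an integral 2-torsion abscissa, the formal germ; then either a non-blind integral root — E-an-48, E-an-53 and the
certificate theorem `ManinOddOfOddEtaExponent_holds` — or all roots blind — §1.  CONDITIONAL reduction; nothing about BSD or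
Manin's conjecture is proved. [cite: Kato2004Asterisque, Thm. 9.7 (p. 189) (shape of F♯)]
[cite: ConradEdixhovenStein2003, §6.1.2 and §6.2 (F★)] -/
theorem not_two_dvd_maninConstant_of_katoFact_of_levelLaws
    (hF : kato_neron_isIntegral_twistedSymbolSum_of_additive_two_real)
    (hFstar : optimalGamma1Parametrization_cusp_rational) (hex : exists_optimal_gamma1ParametrizationData)
    {N : ℕ} [NeZero N] (h4 : 2 ^ 2 ∣ N)
    (h48N : ∀ (V : WeierstrassCurve ℚ) [V.IsElliptic] [V.IsGloballyMinimal] (D : ModularParametrizationData V N)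
      (a : ℕ → ℤ), (∀ n, (a n : ℂ) = cuspCoeff D.f n) →
      (∀ z ∈ D.L.lattice, ∃ w ∈ periodLattice D.f, z = D.c * w) →
      ∀ e : ℚ, V.twoTorsionPolynomial.toPoly.IsRoot e → ∀ z : ℚ⟦X⟧, IsParamGerm V D.c a z →
      ∃ (r : ℕ → ℤ) (g A B : ℤ⟦X⟧), IsCuspidalKummerRep N (kummerSeries V D.c e z) r g A B)
    (h53N : ∀ (V : WeierstrassCurve ℚ) [V.IsElliptic] [V.IsGloballyMinimal] (D : ModularParametrizationData V N)
      (a : ℕ → ℤ), (∀ n, (a n : ℂ) = cuspCoeff D.f n) →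
      (∀ z ∈ D.L.lattice, ∃ w ∈ periodLattice D.f, z = D.c * w) →
      ∀ (a₂ a₄ e : ℤ), V.a₁ = 0 → V.a₃ = 0 → V.a₂ = a₂ → V.a₄ = a₄ →
      V.twoTorsionPolynomial.toPoly.IsRoot (e : ℚ) → ¬ KummerBlindAtTwo a₂ a₄ e →
      ∀ z : ℚ⟦X⟧, IsParamGerm V D.c a z →
      ∀ (r : ℕ → ℤ) (g A B : ℤ⟦X⟧), IsCuspidalKummerRep N (kummerSeries V D.c ((e : ℚ)) z) r g A B →
      ∃ δ ∈ N.divisors, Odd (r δ))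
    (h110N : ∀ (V : WeierstrassCurve ℚ) [V.IsElliptic] [V.IsGloballyMinimal] (D₁ : Gamma1ParametrizationData V N),
      D₁.IsOptimal → KatoFactTwoAt V D₁.f)
    (W : WeierstrassCurve ℚ) [W.IsElliptic] [W.IsGloballyMinimal] (D : ModularParametrizationData W N)
    (hopt : ∀ z ∈ D.L.lattice, ∃ w ∈ periodLattice D.f, z = D.c * w) :
    ¬ (2 : ℤ) ∣ D.maninConstant := by
  by_cases hirr : W.HasIrreducibleModPGaloisRep 2
  · exact katoManinOddTwo_of_realKatoFact_of_generation hF multiShiftClassGenerationTwo_holds W D hopt h4 hirr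
  have h4' : 4 ∣ N := by norm_num at h4; exact h4
  -- additive reduction at `2`
  obtain ⟨h2, hN2⟩ := lFunction_two_eq_zero_of_four_dvd W D.isNewformOf h4'
  have hadd := hasAdditiveReductionAt_two_of_lFunction_two_eq_zero W h2 hN2
  -- the `a₁ = a₃ = 0` companion and the transported datum
  obtain ⟨C, M, hu, hCW, hM1, hM3, hmin⟩ := exists_smul_eq_map_a₁_a₃_eq_zero_of_hasAdditiveReductionAt_two W hadd
  haveI := hmin
  obtain ⟨D', hf, hc, hL, -⟩ := exists_modularParametrizationData_smul_of_u_eq_one W D C hu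
  have hopt' : ∀ z ∈ D'.L.lattice, ∃ w ∈ periodLattice D'.f, z = D'.c * w := by
    rw [hL, hf, hc]; exact hopt
  have ha₁ : (C • W).a₁ = 0 := by rw [hCW, map_a₁, hM1, map_zero]
  have ha₃ : (C • W).a₃ = 0 := by rw [hCW, map_a₃, hM3, map_zero]
  have ha₂ : (C • W).a₂ = (M.a₂ : ℚ) := by rw [hCW, map_a₂, eq_intCast]
  have ha₄ : (C • W).a₄ = (M.a₄ : ℚ) := by rw [hCW, map_a₄, eq_intCast]
  -- an integral `2`-torsion abscissa
  have hred' : ¬ (C • W).HasIrreducibleModPGaloisRep 2 := by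
    rwa [Mazur1978.hasIrreducibleModPGaloisRep_smul_iff]
  obtain ⟨e, he⟩ := exists_isRoot_twoTorsionPolynomial_of_not_hasIrreducibleModPGaloisRep_two (C • W) hred'
  have heM : (M.map (Int.castRingHom ℚ)).twoTorsionPolynomial.toPoly.IsRoot e := hCW ▸ he
  obtain ⟨e₀, rfl⟩ := exists_intCast_eq_of_isRoot_twoTorsionPolynomial M hM1 hM3 heM
  -- integer newform coefficients and the formal germ of `E_{C • W, c}`
  set a : ℕ → ℤ := fun n => (C • W).LFunction n with ha_def
  have ha : ∀ n, (a n : ℂ) = cuspCoeff D'.f n := fun n => (D'.isNewformOf.2 n).symm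
  obtain ⟨z, hz⟩ := exists_isParamGerm (C • W) D'.c a
  -- dichotomy: some integral root is not Kummer-blind, or all are blind
  by_cases hnb : ∃ e₁ : ℤ, (C • W).twoTorsionPolynomial.toPoly.IsRoot (e₁ : ℚ) ∧ ¬ KummerBlindAtTwo M.a₂ M.a₄ e₁
  · obtain ⟨e₁, he₁, hnb₁⟩ := hnb
    obtain ⟨r, g, A, B, hrep⟩ := h48N (C • W) D' a ha hopt' (e₁ : ℚ) he₁ z hz
    have hodd : ∃ δ ∈ N.divisors, Odd (r δ) :=
      h53N (C • W) D' a ha hopt' M.a₂ M.a₄ e₁ ha₁ ha₃ ha₂ ha₄ he₁ hnb₁ z hz r g A B hrep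
    have h := ManinOddOfOddEtaExponent_holds (C • W) D' a ha h4' (e₁ : ℚ) he₁ z hz r g A B hrep hodd
    change ¬ (2 : ℤ) ∣ D'.c at h
    change ¬ (2 : ℤ) ∣ D.c
    rwa [hc] at h
  · push Not at hnb
    have h := kummerBlindResidualOddAt_of_cusp_rational_of_katoFactAt hFstar hex h4 h110N (C • W) D' hopt'
      M.a₂ M.a₄ ha₁ ha₃ ha₂ ha₄ hnb
    change ¬ (2 : ℤ) ∣ D'.c at h
    change ¬ (2 : ℤ) ∣ D.c
    rwa [hc] at h

/-! ## §3 Stub 6′ RECUT (es §40.12 (v)): odd symbol-closure neighbours are discharged by F-es-21♭K (p3 p699401) -/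

/-- **`KatoFactTwoAt` at every `X₁(N)`-optimal curve of level `N`, from F-es-21♭K and the RECUT law**: if the optimal curve `V`
has a globally minimal neighbour `V′`, isogenous to `V` by an odd-degree isogeny, which is a symbol-closure curve for the newform,
F-es-21♭K gives `KatoFactTwoAt V` (p3's `katoFactTwoAt_of_oddIsogeny_of_isSymbolClosureCurve`); otherwise the recut law applies.
[cite: Kato2004Asterisque, (8.1.3) (p. 180) and Thm. 12.5 (1) (p. 221) (shape of F-es-21♭K)] -/
theorem katoFactTwoAt_of_symbolClosure_of_recut (hK : kato_isIntegral_twistedSymbolSum_two_symbolClosure)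
    {N : ℕ} [NeZero N] (h4 : 2 ^ 2 ∣ N)
    (V : WeierstrassCurve ℚ) [V.IsElliptic] [V.IsGloballyMinimal] (D₁ : Gamma1ParametrizationData V N)
    (hrecut : (¬ ∃ (V' : WeierstrassCurve ℚ) (_ : V'.IsElliptic) (_ : V'.IsGloballyMinimal) (ψ : Isogeny V' V),
        Odd ψ.degree ∧ IsSymbolClosureCurve V' D₁.f) → KatoFactTwoAt V D₁.f) :
    KatoFactTwoAt V D₁.f := by
  by_cases h : ∃ (V' : WeierstrassCurve ℚ) (_ : V'.IsElliptic) (_ : V'.IsGloballyMinimal) (ψ : Isogeny V' V),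
      Odd ψ.degree ∧ IsSymbolClosureCurve V' D₁.f
  · obtain ⟨V', _, _, ψ, hodd, hsc⟩ := h
    exact katoFactTwoAt_of_oddIsogeny_of_isSymbolClosureCurve hK V V' D₁.f h4 ψ hodd hsc
  · exact hrecut h

/-! ## §4 The `16 ∣ N` reading: `ManinOddAtSixteen` and the ROUTE DECL from seven inputs (skeleton v16 of `kato_shift_two`) -/

/-- **`ManinOddAtSixteen` ⟸ F♯ ∧ F★ ∧ hex ∧ F-es-21♭K ∧ (E-an-48, E-an-53, recut E-es-110 READ AT `16 ∣ N`)** — the composition of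
skeleton v16 of line `kato_shift_two` up to p2's print-free glue.  The three law hypotheses are an's / es's `@[conjecture]` bodies
VERBATIM with `4 ∣ N` replaced by `2 ^ 4 ∣ N` (E-an-48, E-an-53) resp. with the binders `2 ^ 4 ∣ N →` and «no odd symbol-closure
neighbour» added (E-es-110).  CONDITIONAL reduction; `ManinOddAtSixteen`, C2, Manin's conjecture and BSD are NOT proved.
[cite: Kato2004Asterisque, Thm. 9.7 (p. 189) (F♯) and Thm. 12.5 (1) (p. 221) (F-es-21♭K)] [cite: ConradEdixhovenStein2003, §6.1.2 and §6.2 (F★)]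
[cite: Stevens1989, §2 (existence of the optimal X₁(N)-datum)] -/
theorem maninOddAtSixteen_of_katoFact_of_levelSixteenLaws
    (hF : kato_neron_isIntegral_twistedSymbolSum_of_additive_two_real)
    (hFstar : optimalGamma1Parametrization_cusp_rational) (hex : exists_optimal_gamma1ParametrizationData)
    (hK : kato_isIntegral_twistedSymbolSum_two_symbolClosure)
    (h48 : ∀ (W : WeierstrassCurve ℚ) [W.IsElliptic] [W.IsGloballyMinimal] {N : ℕ} [NeZero N]
      (D : ModularParametrizationData W N) (a : ℕ → ℤ), (∀ n, (a n : ℂ) = cuspCoeff D.f n) →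
      2 ^ 4 ∣ N → (∀ z ∈ D.L.lattice, ∃ w ∈ periodLattice D.f, z = D.c * w) →
      ∀ e : ℚ, W.twoTorsionPolynomial.toPoly.IsRoot e →
      ∀ z : ℚ⟦X⟧, IsParamGerm W D.c a z →
      ∃ (r : ℕ → ℤ) (g A B : ℤ⟦X⟧), IsCuspidalKummerRep N (kummerSeries W D.c e z) r g A B)
    (h53 : ∀ (W : WeierstrassCurve ℚ) [W.IsElliptic] [W.IsGloballyMinimal] {N : ℕ} [NeZero N]
      (D : ModularParametrizationData W N) (a : ℕ → ℤ), (∀ n, (a n : ℂ) = cuspCoeff D.f n) →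
      2 ^ 4 ∣ N → (∀ z ∈ D.L.lattice, ∃ w ∈ periodLattice D.f, z = D.c * w) →
      ∀ (a₂ a₄ e : ℤ), W.a₁ = 0 → W.a₃ = 0 → W.a₂ = a₂ → W.a₄ = a₄ →
      W.twoTorsionPolynomial.toPoly.IsRoot (e : ℚ) → ¬ KummerBlindAtTwo a₂ a₄ e →
      ∀ z : ℚ⟦X⟧, IsParamGerm W D.c a z →
      ∀ (r : ℕ → ℤ) (g A B : ℤ⟦X⟧), IsCuspidalKummerRep N (kummerSeries W D.c ((e : ℚ)) z) r g A B →
      ∃ δ ∈ N.divisors, Odd (r δ))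
    (h110 : ∀ (V : WeierstrassCurve ℚ) [V.IsElliptic] [V.IsGloballyMinimal] {N : ℕ} [NeZero N]
      (D₁ : Gamma1ParametrizationData V N), D₁.IsOptimal → 2 ^ 4 ∣ N →
      (¬ ∃ (V' : WeierstrassCurve ℚ) (_ : V'.IsElliptic) (_ : V'.IsGloballyMinimal) (ψ : Isogeny V' V),
        Odd ψ.degree ∧ IsSymbolClosureCurve V' D₁.f) → KatoFactTwoAt V D₁.f) :
    ManinOddAtSixteen := by
  intro _hMz _hAU _hCs _hnf W _ _ N _ D hopt h16
  have h4 : 2 ^ 2 ∣ N := dvd_trans ⟨4, by norm_num⟩ h16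
  exact not_two_dvd_maninConstant_of_katoFact_of_levelLaws hF hFstar hex h4
    (fun V _ _ D' a ha hopt' => h48 V D' a ha h16 hopt')
    (fun V _ _ D' a ha hopt' => h53 V D' a ha h16 hopt')
    (fun V _ _ D₁ hD₁ => katoFactTwoAt_of_symbolClosure_of_recut hK h4 V D₁ (h110 V D₁ hD₁ h16)) W D hopt

/-- **THE ROUTE DECL `Theses.ManinLocalTwoThree.ManinOddAtFour` BY NAME from the seven inputs of skeleton v16** (F♯, F★, hex,
F-es-21♭K printed / statement-only; E-an-48, E-an-53, recut E-es-110 READ AT `16 ∣ N`), through p2's print-free glue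
`maninOddAtFour_of_maninOddAtSixteen'` (S-an-58 and S-an-60 are theorems: the `χ₋₄` rotation moves every lattice-optimal datum with
`4 ∥ N` or `8 ∥ N` to one with `16 ∣ N′` and the same constant).  CONDITIONAL reduction = the composition `ManinOddAtFour_of` of
skeleton v16; C2, Manin's conjecture and BSD are NOT proved. [cite: Kato2004Asterisque, Thm. 9.7 (p. 189) and Thm. 12.5 (1) (p. 221)]
[cite: ConradEdixhovenStein2003, §6.1.2 and §6.2] [cite: Stevens1989, §2] -/
theorem maninOddAtFour_of_katoFact_of_levelSixteenLaws
    (hF : kato_neron_isIntegral_twistedSymbolSum_of_additive_two_real)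
    (hFstar : optimalGamma1Parametrization_cusp_rational) (hex : exists_optimal_gamma1ParametrizationData)
    (hK : kato_isIntegral_twistedSymbolSum_two_symbolClosure)
    (h48 : ∀ (W : WeierstrassCurve ℚ) [W.IsElliptic] [W.IsGloballyMinimal] {N : ℕ} [NeZero N]
      (D : ModularParametrizationData W N) (a : ℕ → ℤ), (∀ n, (a n : ℂ) = cuspCoeff D.f n) →
      2 ^ 4 ∣ N → (∀ z ∈ D.L.lattice, ∃ w ∈ periodLattice D.f, z = D.c * w) →
      ∀ e : ℚ, W.twoTorsionPolynomial.toPoly.IsRoot e →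
      ∀ z : ℚ⟦X⟧, IsParamGerm W D.c a z →
      ∃ (r : ℕ → ℤ) (g A B : ℤ⟦X⟧), IsCuspidalKummerRep N (kummerSeries W D.c e z) r g A B)
    (h53 : ∀ (W : WeierstrassCurve ℚ) [W.IsElliptic] [W.IsGloballyMinimal] {N : ℕ} [NeZero N]
      (D : ModularParametrizationData W N) (a : ℕ → ℤ), (∀ n, (a n : ℂ) = cuspCoeff D.f n) →
      2 ^ 4 ∣ N → (∀ z ∈ D.L.lattice, ∃ w ∈ periodLattice D.f, z = D.c * w) →
      ∀ (a₂ a₄ e : ℤ), W.a₁ = 0 → W.a₃ = 0 → W.a₂ = a₂ → W.a₄ = a₄ →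
      W.twoTorsionPolynomial.toPoly.IsRoot (e : ℚ) → ¬ KummerBlindAtTwo a₂ a₄ e →
      ∀ z : ℚ⟦X⟧, IsParamGerm W D.c a z →
      ∀ (r : ℕ → ℤ) (g A B : ℤ⟦X⟧), IsCuspidalKummerRep N (kummerSeries W D.c ((e : ℚ)) z) r g A B →
      ∃ δ ∈ N.divisors, Odd (r δ))
    (h110 : ∀ (V : WeierstrassCurve ℚ) [V.IsElliptic] [V.IsGloballyMinimal] {N : ℕ} [NeZero N]
      (D₁ : Gamma1ParametrizationData V N), D₁.IsOptimal → 2 ^ 4 ∣ N →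
      (¬ ∃ (V' : WeierstrassCurve ℚ) (_ : V'.IsElliptic) (_ : V'.IsGloballyMinimal) (ψ : Isogeny V' V),
        Odd ψ.degree ∧ IsSymbolClosureCurve V' D₁.f) → KatoFactTwoAt V D₁.f) :
    Summit.BirchSwinnertonDyer.BirchSwinnertonDyer.Theses.ManinLocalTwoThree.ManinOddAtFour :=
  maninOddAtFour_of_maninOddAtSixteen' (maninOddAtSixteen_of_katoFact_of_levelSixteenLaws hF hFstar hex hK h48 h53 h110)

/-! ## §5 Check: v15's GLOBAL composition re-derived from the level-wise theorem (laws at every `4 ∣ N`; E-es-110 instead of C2¹) -/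

/-- **C2 BY NAME from F♯ ∧ E-an-48 ∧ E-an-53 ∧ F★ ∧ hex ∧ E-es-110** (the hypothesis set of skeleton v15, its derived stub C2¹
replaced by its Néron half E-es-110; E-es-111 is the theorem `twoAdicGammaOneWitnessLaw_holds`) — one line over §2, confirming the
level-wise theorem subsumes the composition of record p683655 + p688868.  CONDITIONAL; nothing about BSD or Manin's conjecture is proved.
[cite: Kato2004Asterisque, Thm. 9.7 (p. 189)] [cite: ConradEdixhovenStein2003, §6.1.2 and §6.2] -/
theorem maninOddAtFour_of_katoFact_of_cuspidalKummer_of_cusp_rational_of_katoGamma1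
    (hF : kato_neron_isIntegral_twistedSymbolSum_of_additive_two_real)
    (h48 : CuspidalKummerRepresentativeAtFour) (h53 : CuspidalKummerOddExponent)
    (hFstar : optimalGamma1Parametrization_cusp_rational) (hex : exists_optimal_gamma1ParametrizationData)
    (h110 : KatoNeronIntegralTwoGamma1Optimal) :
    Summit.BirchSwinnertonDyer.BirchSwinnertonDyer.Theses.ManinLocalTwoThree.ManinOddAtFour := by
  intro _hMz _hAU _hCs _hnf W _ _ N _ D hopt h4
  have h4' : 4 ∣ N := by norm_num at h4; exact h4
  exact not_two_dvd_maninConstant_of_katoFact_of_levelLaws hF hFstar hex h4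
    (fun V _ _ D' a ha hopt' => h48 V D' a ha h4' hopt')
    (fun V _ _ D' a ha hopt' => h53 V D' a ha h4' hopt')
    (fun V _ _ D₁ hD₁ => h110 V D₁ hD₁) W D hopt

/-! ## §6 (APPEND, p1 g13) The recut stub's exceptional locus is inhabited by the symbol-closure curves themselves

Stub 6″ of skeleton v16 excuses every optimal `X₁(N)`-curve with a globally minimal ODD-degree-isogenous symbol-closure
neighbour.  A symbol-closure curve is its own such neighbour (identity isogeny, degree `1`), so on es's two-power-homothety locus
(`𝓛̄_f = 2^{-j}Λ₁(f)`: 17/21 blind classes `4 ∣ N ≤ 5000`, es §40.13) the recut law is never invoked — kernel-checked below. -/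

/-- **A symbol-closure curve is its own odd symbol-closure neighbour** (the identity isogeny `Isogeny.id V` has degree `1`).
[cite: SilvermanAEC2009, III.4, Example 4.1 (identity isogeny)] -/
theorem exists_oddSymbolClosureNeighbour_of_isSymbolClosureCurve
    (V : WeierstrassCurve ℚ) [V.IsElliptic] [V.IsGloballyMinimal] {N : ℕ} (f : CuspForm (Gamma0 N) 2)
    (hsc : IsSymbolClosureCurve V f) :
    ∃ (V' : WeierstrassCurve ℚ) (_ : V'.IsElliptic) (_ : V'.IsGloballyMinimal) (ψ : Isogeny V' V),
      Odd ψ.degree ∧ IsSymbolClosureCurve V' f :=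
  ⟨V, inferInstance, inferInstance, Isogeny.id V, by rw [Isogeny.degree_id]; exact odd_one, hsc⟩

/-- **On the two-power-homothety locus the recut stub 6″ is idle**: an OPTIMAL `X₁(N)`-datum whose newform has
`closure (range (modularSymbol f)) = 2^{-j}·Λ₁(f)` is a symbol-closure curve (p3's `isSymbolClosureCurve_of_isOptimal_of_twoPow`,
es g26b §B), hence has an odd symbol-closure neighbour — the negated hypothesis of stub 6″ fails there.
[cite: Wuthrich2014, §1 and §3 (the lattice of all modular symbols)] -/
theorem exists_oddSymbolClosureNeighbour_of_isOptimal_of_twoPow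
    {V : WeierstrassCurve ℚ} [V.IsElliptic] [V.IsGloballyMinimal] {N : ℕ} [NeZero N]
    (D₁ : Gamma1ParametrizationData V N) (hopt : D₁.IsOptimal) (j : ℕ)
    (hj : ∀ z : ℂ, z ∈ AddSubgroup.closure (Set.range (modularSymbol D₁.f)) ↔
      (2 : ℂ) ^ j * z ∈ periodLatticeGamma1 D₁.f) :
    ∃ (V' : WeierstrassCurve ℚ) (_ : V'.IsElliptic) (_ : V'.IsGloballyMinimal) (ψ : Isogeny V' V),
      Odd ψ.degree ∧ IsSymbolClosureCurve V' D₁.f :=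
  exists_oddSymbolClosureNeighbour_of_isSymbolClosureCurve V D₁.f (isSymbolClosureCurve_of_isOptimal_of_twoPow D₁ hopt j hj)

/-- **Stub 6″ restricted AWAY from the two-power-homothety locus suffices**: if the recut law is assumed only for optimal
`X₁(N)`-data that are NOT two-power-homothetic (no `j` with `𝓛̄_f = 2^{-j}Λ₁(f)`), the hypothesis `h110` of
`maninOddAtSixteen_of_katoFact_of_levelSixteenLaws` still holds (the homothetic data have an odd symbol-closure neighbour, so
the recut law's premise is void there).  Pure logic over §6; recorded for the census reading of v16. [folklore] -/
theorem levelSixteenRecutLaw_of_offTwoPow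
    (h110' : ∀ (V : WeierstrassCurve ℚ) [V.IsElliptic] [V.IsGloballyMinimal] {N : ℕ} [NeZero N]
      (D₁ : Gamma1ParametrizationData V N), D₁.IsOptimal → 2 ^ 4 ∣ N →
      (¬ ∃ j : ℕ, ∀ z : ℂ, z ∈ AddSubgroup.closure (Set.range (modularSymbol D₁.f)) ↔
        (2 : ℂ) ^ j * z ∈ periodLatticeGamma1 D₁.f) →
      (¬ ∃ (V' : WeierstrassCurve ℚ) (_ : V'.IsElliptic) (_ : V'.IsGloballyMinimal) (ψ : Isogeny V' V),
        Odd ψ.degree ∧ IsSymbolClosureCurve V' D₁.f) → KatoFactTwoAt V D₁.f) :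
    ∀ (V : WeierstrassCurve ℚ) [V.IsElliptic] [V.IsGloballyMinimal] {N : ℕ} [NeZero N]
      (D₁ : Gamma1ParametrizationData V N), D₁.IsOptimal → 2 ^ 4 ∣ N →
      (¬ ∃ (V' : WeierstrassCurve ℚ) (_ : V'.IsElliptic) (_ : V'.IsGloballyMinimal) (ψ : Isogeny V' V),
        Odd ψ.degree ∧ IsSymbolClosureCurve V' D₁.f) → KatoFactTwoAt V D₁.f := by
  intro V _ _ N _ D₁ hopt h16 hno
  refine h110' V D₁ hopt h16 ?_ hno
  rintro ⟨j, hj⟩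
  exact hno (exists_oddSymbolClosureNeighbour_of_isOptimal_of_twoPow D₁ hopt j hj)

end Summit.BirchSwinnertonDyer.BirchSwinnertonDyer.Theorems.ManinLocalTwoThree

end
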